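import Mathlib
import Summits.NavierStokesRegularity.NavierStokesRegularity.Theorems.L3TimeExponentPincerRingDatumVorticity
import Literature.Analysis.FluidPDE.NSLerayHopfSereginEnergyProofs
import Literature.Analysis.FluidPDE.VorticityCalculus
import HarnessLib.Audit
import HarnessLib

/-!
# L3TimeExponentPincer — ring datum calculus III: the compactly supported ring field is a
# Schwartz-frame datum

Support kernel for the crux `L3CascadeJaw` (item stmt-NavierStokesRegularity-19499): third
calculus step of the explicit ring datum for `lpPersistence_of_ringData`.  If the profile
`F ∈ C^∞(ℝ)` vanishes on `[R, ∞)` then the potential `A = F(|x|²) J` and the ring field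
`u₀ = curl A` are compactly supported (support in the closed ball of radius `√R`), hence `u₀` is
a datum of the crux's frame: smooth, divergence free, rapidly decaying, axisymmetric without swirl
(`ringField_frame`), with `ω_θ/r = −(4|x|²F'' + 10F')(|x|²)` (`angVortQuot_ringField`).
WHAT THIS IS NOT: pure calculus.
-/

namespace Summit.NavierStokesRegularity.NavierStokesRegularity.Theorems.L3TimeExponentPincerRingDatumFrame

open Real Set Metric Literature.Analysis.FluidPDE
open Summit.NavierStokesRegularity.NavierStokesRegularity.Theorems.L3TimeExponentPincerRingDatumVorticity
open scoped ContDiff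

variable {F : ℝ → ℝ} {R : ℝ}

/-- If `F = 0` on `[R, ∞)` then `A = F(|x|²) J` is supported in the closed ball of radius `√R`. -/
theorem support_radial_smul_rotGen_subset (hR : 0 ≤ R) (hF0 : ∀ s, R ≤ s → F s = 0) :
    Function.support (fun y : EuclideanSpace ℝ (Fin 3) => F (‖y‖ ^ 2) • rotGen y) ⊆
      closedBall (0 : EuclideanSpace ℝ (Fin 3)) (Real.sqrt R) := by
  intro y hy
  rw [mem_closedBall, dist_zero_right]
  by_contra h
  rw [not_le] at h
  have h2 : R ≤ ‖y‖ ^ 2 := by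
    have hs : Real.sqrt R ^ 2 = R := Real.sq_sqrt hR
    nlinarith [Real.sqrt_nonneg R, norm_nonneg y]
  exact hy (by simp [hF0 _ h2])

/-- **Compact support of the potential** `A = F(|x|²) J` when `F = 0` on `[R, ∞)`. -/
theorem hasCompactSupport_radial_smul_rotGen (hR : 0 ≤ R) (hF0 : ∀ s, R ≤ s → F s = 0) :
    HasCompactSupport (fun y : EuclideanSpace ℝ (Fin 3) => F (‖y‖ ^ 2) • rotGen y) :=
  HasCompactSupport.of_support_subset_isCompact (isCompact_closedBall 0 (Real.sqrt R))
    (support_radial_smul_rotGen_subset hR hF0)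

/-- **Compact support of the ring field** `u₀ = curl (F(|x|²) J)`. -/
theorem hasCompactSupport_ringField (hR : 0 ≤ R) (hF0 : ∀ s, R ≤ s → F s = 0) :
    HasCompactSupport (curl fun y : EuclideanSpace ℝ (Fin 3) => F (‖y‖ ^ 2) • rotGen y) :=
  hasCompactSupport_curl (hasCompactSupport_radial_smul_rotGen hR hF0)

/-- **The ring field is a frame datum.**  For `F ∈ C^∞(ℝ)` vanishing on `[R, ∞)` (`0 ≤ R`), the
ring field `u₀ = curl (F(|x|²) J)` is smooth, divergence free, rapidly decaying (compactly
supported), axisymmetric and without swirl. -/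
theorem ringField_frame (hF : ContDiff ℝ ∞ F) (hR : 0 ≤ R) (hF0 : ∀ s, R ≤ s → F s = 0) :
    ContDiff ℝ ∞ (curl fun y : EuclideanSpace ℝ (Fin 3) => F (‖y‖ ^ 2) • rotGen y) ∧
    VectorCalculus.IsDivFree (curl fun y : EuclideanSpace ℝ (Fin 3) => F (‖y‖ ^ 2) • rotGen y) ∧
    HasRapidSpatialDecay (curl fun y : EuclideanSpace ℝ (Fin 3) => F (‖y‖ ^ 2) • rotGen y) ∧
    IsAxisymmetric (curl fun y : EuclideanSpace ℝ (Fin 3) => F (‖y‖ ^ 2) • rotGen y) ∧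
    HasNoSwirl (curl fun y : EuclideanSpace ℝ (Fin 3) => F (‖y‖ ^ 2) • rotGen y) := by
  have hA : ContDiff ℝ ∞ (fun y : EuclideanSpace ℝ (Fin 3) => F (‖y‖ ^ 2) • rotGen y) :=
    contDiff_radial_smul_rotGen hF
  have hA' : ContDiff ℝ (((⊤ : ℕ∞) + 1 : ℕ∞) : WithTop ℕ∞)
      (fun y : EuclideanSpace ℝ (Fin 3) => F (‖y‖ ^ 2) • rotGen y) := by simpa using hA
  have hsm : ContDiff ℝ ∞ (curl fun y : EuclideanSpace ℝ (Fin 3) => F (‖y‖ ^ 2) • rotGen y) :=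
    contDiff_curl (n := (⊤ : ℕ∞)) hA'
  refine ⟨hsm, isDivFree_ringField (hF.of_le (by norm_cast)),
    HasRapidSpatialDecay.of_hasCompactSupport hsm (hasCompactSupport_ringField hR hF0),
    isAxisymmetric_ringField (hF.of_le (by norm_cast)),
    hasNoSwirl_ringField (hF.differentiable (by simp))⟩

end Summit.NavierStokesRegularity.NavierStokesRegularity.Theorems.L3TimeExponentPincerRingDatumFrame
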